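import Literature.Analysis.FunctionSpaces.TorusShearKoopman
import Literature.Analysis.FunctionSpaces.TorusSpaceTime
import Literature.Analysis.FunctionSpaces.TorusCalculusProofs
import Literature.Analysis.FluidPDE.PassiveScalar
import Literature.Analysis.FluidPDE.TorusForceBookkeeping
import HarnessLib

/-!
# One shear stage in time: the drift, its kinematics, and the transport of profiles by a
# moving transversal shear

Analysis/FluidPDE support file (all proved; no named facts) for the alternating-shear discharge
of `Literature.Analysis.FluidPDE.cheskidov_time_periodic_anomaly` (`ShearCascade*`). A stage of
the cascade moves the torus by the transversal shear `x ↦ x - a(t)φ(x_j)eᵢ` (`Torus.shearMap`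
with the profile `ShearStage.amp φ (a t)`); its Eulerian velocity is the **shear drift**
`ShearStage.drift i j φ (ȧ t) = (ȧ(t)φ(x_j)) eᵢ`. Contents:

* `ShearStage.drift`: smooth, FunctionSpaces.Torus.divergence free (`i ≠ j`), mean zero when `∫₀¹φ = 0`
  (`hasZeroMean_drift`, via `Torus.mFourierCoeff_comp_eval_single`), a steady Euler flow with
  zero pressure — `(V·∇)V = 0` (`convect_drift_self`) —, with `‖V‖ = |ȧ||φ(x_j)|`, the energy
  bound `∫‖V‖² ≤ (|ȧ| sup|φ|)²`, a uniform Laplacian bound `‖ΔV‖ ≤ |ȧ| C_φ`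
  (`exists_norm_laplacian_drift_le`), and joint smoothness in `(t, x)` for smooth `ȧ`
  (`isSmoothSpaceTimeOn_drift`);
* `ShearStage.moved G i j φ a (t, x) = G(t, x - a(t)φ(x_j)eᵢ)`: joint smoothness is preserved
  (`isSmoothSpaceTimeOn_moved`, through the smooth space–time lift `movedLift`);
* **the transport identity** `transport_moved_static` /
  `isClassicalScalarTransportOn_moved_static`: for a smooth static profile `Θ`, the field
  `Θ(x - a(t)φ(x_j)eᵢ)` is a classical solution of `∂ₜf + V·∇f = 0` on `ℝ × T²` with the shear
  drift (chain rule on the lifts: the time derivative is `DΘ[-ȧφeᵢ]`, the advection term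
  `DΘ[DΦ V] = DΘ[V]` because the shear only reads `x_j` and `V ∥ eᵢ`);
* locality of time derivatives and of the transport residual (`timeDerivWithin_univ_congr`,
  `transport_congr`) and boundedness of smooth torus functions (`exists_forall_norm_le`), used to
  glue the stages of the cascade in time.

## Mathlib / tree search

Tree: `Torus.shearMap`/`shearMapLift`/`shearMap_proj`/`lift_comp_shearMap` (`TorusShearKoopman`),
`Torus.inner_gradient_left`, `Torus.fderiv_lift` (`TorusCalculus(Proofs)`),
`Torus.IsClassicalScalarTransportOn` (`PassiveScalar`), `Torus.laplacian_const_smul'`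
(`TorusForceBookkeeping`); the leaf framework `PlanarPullbackTransport` proves the analogous
planar identities for explicit pullbacks on `ℝ²` — here the torus form with `Torus.shearMap` is
needed. Mathlib: `HasFDerivAt.comp_hasDerivAt`, `fderiv_comp`, `ContDiff.deriv'`.

## References

* C. Bardos, E. S. Titi, E. Wiedemann, C. R. Math. Acad. Sci. Paris 350 (2012), Lemma 4
  (transport by a shear flow).
-/

open MeasureTheory Set Filter Topology Function UnitAddTorus
open scoped ContDiff InnerProductSpace
open Literature.Analysis.FunctionSpaces.Torus

noncomputable section

namespace Literature.Analysis.FluidPDE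

namespace ShearStage

/-- The flat two-torus (local notation). [folklore] -/
local notation "𝕋²" => UnitAddTorus (Fin 2)
/-- `ℝ²` (local notation). [folklore] -/
local notation "E²" => EuclideanSpace ℝ (Fin 2)

/-! ## Amplitude scaling of a profile -/

/-- The profile `c · φ`. [folklore] -/
def amp (P : ShearProfile) (c : ℝ) : ShearProfile where
  toFun := fun t => c * P t
  periodic' := fun t => by simp [P.periodic t]
  contDiff' := contDiff_const.mul P.contDiff

/-- Values of the scaled profile. [folklore] -/
@[simp]
theorem amp_apply (P : ShearProfile) (c t : ℝ) : amp P c t = c * P t := rfl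

/-- On the circle: `(c φ)(b) = c φ(b)`. [folklore] -/
@[simp]
theorem onCircle_amp (P : ShearProfile) (c : ℝ) (b : UnitAddCircle) : (amp P c).onCircle b = c * P.onCircle b := by
  induction b using QuotientAddGroup.induction_on
  rw [ShearProfile.onCircle_coe, ShearProfile.onCircle_coe, amp_apply]

/-- The shear with amplitude `0` is the identity. [folklore] -/
theorem shearMap_amp_zero (i j : Fin 2) (P : ShearProfile) (x : 𝕋²) : shearMap i j (amp P 0) x = x := by
  rw [shearMap_apply, onCircle_amp, zero_mul]
  simp

/-- The shear with amplitude `1` is the shear of `P`. [folklore] -/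
theorem shearMap_amp_one (i j : Fin 2) (P : ShearProfile) (x : 𝕋²) : shearMap i j (amp P 1) x = shearMap i j P x := by
  rw [shearMap_apply, shearMap_apply, onCircle_amp, one_mul]

/-! ## The drift of a shear stage -/

/-- **The shear drift** `x ↦ (b φ(x_j)) eᵢ` (the Eulerian velocity of the moving shear
`x ↦ x - a(t)φ(x_j)eᵢ` is this field with `b = ȧ(t)`). [folklore] -/
def drift (i j : Fin 2) (P : ShearProfile) (b : ℝ) (x : 𝕋²) : E² :=
  (b * P.onCircle (x j)) • EuclideanSpace.single i (1 : ℝ)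

/-- Unfolding the drift. [folklore] -/
theorem drift_apply (i j : Fin 2) (P : ShearProfile) (b : ℝ) (x : 𝕋²) :
    drift i j P b x = (b * P.onCircle (x j)) • EuclideanSpace.single i (1 : ℝ) := rfl

/-- The drift with `b = 0` vanishes. [folklore] -/
@[simp]
theorem drift_zero (i j : Fin 2) (P : ShearProfile) : drift i j P 0 = 0 := by
  funext x; simp [drift_apply]

/-- The scalar factor `x ↦ φ(x_j)` is smooth on the torus. [folklore] -/
theorem isSmooth_onCircle_comp (j : Fin 2) (P : ShearProfile) : IsSmooth fun x : 𝕋² => P.onCircle (x j) := by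
  unfold IsSmooth lift
  have : (fun y : E² => P.onCircle (proj y j)) = fun y => P (y j) := by
    funext y; rw [proj_apply, ShearProfile.onCircle_coe]
  simp only [Function.comp_def]
  rw [this]
  exact P.contDiff.comp (EuclideanSpace.proj j : E² →L[ℝ] ℝ).contDiff

/-- The drift is smooth. [folklore] -/
theorem isSmooth_drift (i j : Fin 2) (P : ShearProfile) (b : ℝ) : IsSmooth (drift i j P b) := by
  have h : IsSmooth fun x : 𝕋² => b * P.onCircle (x j) := IsSmooth.smul b (isSmooth_onCircle_comp j P)
  exact h.smul' (isSmooth_const _)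

/-- **The drift is FunctionSpaces.Torus.divergence free** (`i ≠ j`: its only nonzero component, the `i`-th, does not
depend on `x_i`). [folklore] -/
theorem isDivFree_drift {i j : Fin 2} (hij : i ≠ j) (P : ShearProfile) (b : ℝ) : IsDivFree (drift i j P b) := by
  intro x
  unfold FunctionSpaces.Torus.divergence FunctionSpaces.Torus.partialDeriv FunctionSpaces.Torus.lineDeriv
  refine Finset.sum_eq_zero fun l _ => ?_
  have : (fun t : ℝ => drift i j P b (x + proj (t • EuclideanSpace.single l (1 : ℝ))) l) = fun _ => drift i j P b x l := by
    funext t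
    by_cases hl : l = i
    · subst hl
      simp [drift_apply, proj_apply, Pi.add_apply, hij.symm]
    · simp [drift_apply, hl]
  rw [this, deriv_const]

/-- The mean of `x ↦ φ(x_j)` over `T²` is the mean of the profile over a period. [folklore] -/
theorem integral_onCircle_comp (j : Fin 2) (P : ShearProfile) : ∫ x : 𝕋², P.onCircle (x j) = ∫ t in (0 : ℝ)..1, P t := by
  have h := mFourierCoeff_comp_eval_single (V := ℂ) (d := Fin 2)
    (Complex.continuous_ofReal.comp P.continuous_onCircle) j 0
  rw [Pi.single_zero, mFourierCoeff_eq_integral_volume, fourierCoeff_eq_intervalIntegral _ 0 0] at h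
  simp only [neg_zero, mFourier_zero, one_smul, zero_add, div_one, fourier_zero, Function.comp_apply,
    ShearProfile.onCircle_coe, ContinuousMap.one_apply] at h
  have h1 : ∫ x : 𝕋², (P.onCircle (x j) : ℂ) = ((∫ x : 𝕋², P.onCircle (x j) : ℝ) : ℂ) := integral_ofReal
  have h2 : ∫ t in (0 : ℝ)..1, (P t : ℂ) = ((∫ t in (0 : ℝ)..1, P t : ℝ) : ℂ) := intervalIntegral.integral_ofReal
  rw [h1, h2] at h
  exact_mod_cast h

/-- **The drift has zero mean** when the profile has zero mean over a period. [folklore] -/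
theorem hasZeroMean_drift (i j : Fin 2) {P : ShearProfile} (hP : ∫ t in (0 : ℝ)..1, P t = 0) (b : ℝ) :
    HasZeroMean (drift i j P b) := by
  unfold HasZeroMean
  simp only [drift_apply]
  rw [integral_smul_const, integral_const_mul, integral_onCircle_comp, hP, mul_zero, zero_smul]

/-- `‖drift x‖ = |b| |φ(x_j)|`. [folklore] -/
theorem norm_drift (i j : Fin 2) (P : ShearProfile) (b : ℝ) (x : 𝕋²) : ‖drift i j P b x‖ = |b| * |P.onCircle (x j)| := by
  rw [drift_apply, norm_smul, PiLp.norm_single, norm_one, mul_one, Real.norm_eq_abs, abs_mul]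

/-- **The drift is a steady Euler flow with zero pressure**: `(V·∇)V = 0`. [folklore] -/
theorem convect_drift_self {i j : Fin 2} (hij : i ≠ j) (P : ShearProfile) (b b' : ℝ) (x : 𝕋²) :
    FunctionSpaces.Torus.convect (drift i j P b) (drift i j P b') x = 0 := by
  unfold FunctionSpaces.Torus.convect
  rw [← lineDeriv_eq_fderiv_apply ((isSmooth_drift i j P b').isContDiff (by simp))]
  unfold FunctionSpaces.Torus.lineDeriv
  have : (fun t : ℝ => drift i j P b' (x + proj (t • drift i j P b x))) = fun _ => drift i j P b' x := by
    funext t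
    simp [drift_apply, proj_apply, Pi.add_apply, smul_smul, hij.symm]
  rw [this, deriv_const]

/-! ## Time-dependent data: space-constant scalar fields -/

/-- A smooth function of time alone is a jointly smooth space–time field. [folklore] -/
theorem isSmoothSpaceTimeOn_time {c : ℝ → ℝ} (hc : ContDiff ℝ ∞ c) (S : Set ℝ) :
    FunctionSpaces.Torus.IsSmoothSpaceTimeOn S (fun t (_ : 𝕋²) => c t) := by
  refine FunctionSpaces.Torus.isSmoothSpaceTimeOn_of_contDiff ?_ S
  have : FunctionSpaces.Torus.stLift (fun t (_ : 𝕋²) => c t) = c ∘ Prod.fst := by funext z; rfl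
  rw [this]; exact hc.comp contDiff_fst

/-- **The time-dependent drift** `(t, x) ↦ (b(t) φ(x_j)) eᵢ` is jointly smooth for smooth `b`. [folklore] -/
theorem isSmoothSpaceTimeOn_drift (i j : Fin 2) (P : ShearProfile) {b : ℝ → ℝ} (hb : ContDiff ℝ ∞ b) (S : Set ℝ) :
    FunctionSpaces.Torus.IsSmoothSpaceTimeOn S (fun t => drift i j P (b t)) := by
  have h : (fun t => drift i j P (b t)) = fun t (x : 𝕋²) => b t • drift i j P 1 x := by
    funext t x; simp [drift_apply, smul_smul]
  rw [h]
  exact (isSmoothSpaceTimeOn_time hb S).smul (FunctionSpaces.Torus.isSmoothSpaceTimeOn_const (isSmooth_drift i j P 1) S)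

/-! ## Moving shears: smoothness in space-time -/

variable {G' : Type*} [NormedAddCommGroup G'] [NormedSpace ℝ G']

/-- **A space–time field composed with a moving shear**: `(t, x) ↦ G(t, x - a(t)φ(x_j)eᵢ)`. [folklore] -/
def moved (G : ℝ → 𝕋² → G') (i j : Fin 2) (P : ShearProfile) (a : ℝ → ℝ) (t : ℝ) (x : 𝕋²) : G' :=
  G t (shearMap i j (amp P (a t)) x)

omit [NormedAddCommGroup G'] [NormedSpace ℝ G'] in
/-- Unfolding `moved`. [folklore] -/
theorem moved_apply (G : ℝ → 𝕋² → G') (i j : Fin 2) (P : ShearProfile) (a : ℝ → ℝ) (t : ℝ) (x : 𝕋²) :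
    moved G i j P a t x = G t (shearMap i j (amp P (a t)) x) := rfl

/-- The planar lift of the moving shear, as a map of space–time. [folklore] -/
def movedLift (i j : Fin 2) (P : ShearProfile) (a : ℝ → ℝ) (z : ℝ × E²) : ℝ × E² :=
  (z.1, shearMapLift i j (amp P (a z.1)) z.2)

/-- The space–time lift of the moving shear is smooth. [folklore] -/
theorem contDiff_movedLift (i j : Fin 2) (P : ShearProfile) {a : ℝ → ℝ} (ha : ContDiff ℝ ∞ a) :
    ContDiff ℝ ∞ (movedLift i j P a) := by
  unfold movedLift shearMapLift
  refine contDiff_fst.prodMk ?_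
  simp only [amp_apply]
  have h : ContDiff ℝ ∞ fun z : ℝ × E² => a z.1 * P (z.2 j) :=
    (ha.comp contDiff_fst).mul (P.contDiff.comp ((EuclideanSpace.proj j : E² →L[ℝ] ℝ).contDiff.comp contDiff_snd))
  exact contDiff_snd.sub (h.smul contDiff_const)

omit [NormedAddCommGroup G'] [NormedSpace ℝ G'] in
/-- `FunctionSpaces.Torus.stLift (moved G) = FunctionSpaces.Torus.stLift G ∘ movedLift`. [folklore] -/
theorem stLift_moved (G : ℝ → 𝕋² → G') (i j : Fin 2) (P : ShearProfile) (a : ℝ → ℝ) :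
    FunctionSpaces.Torus.stLift (moved G i j P a) = FunctionSpaces.Torus.stLift G ∘ movedLift i j P a := by
  funext z
  obtain ⟨t, y⟩ := z
  simp only [FunctionSpaces.Torus.stLift_apply, Function.comp_apply, movedLift, moved_apply, shearMap_proj]

/-- **Composition with a moving shear preserves joint smoothness** (on the whole time axis). [folklore] -/
theorem isSmoothSpaceTimeOn_moved {G : ℝ → 𝕋² → G'} (hG : FunctionSpaces.Torus.IsSmoothSpaceTimeOn univ G) (i j : Fin 2)
    (P : ShearProfile) {a : ℝ → ℝ} (ha : ContDiff ℝ ∞ a) : FunctionSpaces.Torus.IsSmoothSpaceTimeOn univ (moved G i j P a) := by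
  unfold FunctionSpaces.Torus.IsSmoothSpaceTimeOn
  rw [stLift_moved, Set.univ_prod_univ]
  have hG' : ContDiff ℝ ∞ (FunctionSpaces.Torus.stLift G) := by
    have := hG; unfold FunctionSpaces.Torus.IsSmoothSpaceTimeOn at this; rwa [Set.univ_prod_univ, contDiffOn_univ] at this
  exact (hG'.comp (contDiff_movedLift i j P ha)).contDiffOn

/-! ## The transport identity for a static profile carried by a moving shear -/

variable {i j : Fin 2}

/-- The derivative of the moving shear lift in a direction parallel to the displacement axis is
that direction itself (the shear only reads the driving coordinate `x_j`, and `(c eᵢ)_j = 0`). [folklore] -/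
theorem hasFDerivAt_shearMapLift_apply_single (hij : i ≠ j) (P : ShearProfile) (c : ℝ) (y : E²) :
    ∃ L : E² →L[ℝ] E², HasFDerivAt (shearMapLift i j (amp P c)) L y ∧
      ∀ b : ℝ, L (b • EuclideanSpace.single i (1 : ℝ)) = b • EuclideanSpace.single i (1 : ℝ) := by
  -- derivative of `y ↦ (c φ(y_j)) eᵢ`
  have h1 : HasFDerivAt (fun y : E² => y j) (EuclideanSpace.proj j : E² →L[ℝ] ℝ) y :=
    (EuclideanSpace.proj j : E² →L[ℝ] ℝ).hasFDerivAt
  have h2 : HasDerivAt P (deriv P (y j)) (y j) := (P.contDiff.differentiable (by simp)).differentiableAt.hasDerivAt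
  have hφ : HasFDerivAt (fun y : E² => c * P (y j)) (c • (deriv P (y j) • (EuclideanSpace.proj j : E² →L[ℝ] ℝ))) y :=
    (h2.comp_hasFDerivAt y h1).const_mul c
  refine ⟨ContinuousLinearMap.id ℝ E² - (c • (deriv P (y j) • (EuclideanSpace.proj j : E² →L[ℝ] ℝ))).smulRight
    (EuclideanSpace.single i (1 : ℝ)), ?_, fun b => ?_⟩
  · unfold shearMapLift
    simp only [amp_apply]
    exact (hasFDerivAt_id y).sub (hφ.smul_const _)
  · simp [hij.symm]

/-- **Transport of a static profile by a moving shear.** For a smooth `Θ : T² → ℝ`, a smooth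
amplitude `a : ℝ → ℝ` and `i ≠ j`, the field `f(t, x) = Θ(x - a(t)φ(x_j)eᵢ)` satisfies
`∂ₜf + ⟪V, ∇f⟫ = 0` with the drift `V(t, x) = ȧ(t)φ(x_j)eᵢ`, pointwise on `ℝ × T²`. [folklore] -/
theorem transport_moved_static {Θ : 𝕋² → ℝ} (hΘ : IsSmooth Θ) (hij : i ≠ j) (P : ShearProfile)
    {a : ℝ → ℝ} (ha : ContDiff ℝ ∞ a) (t : ℝ) (x : 𝕋²) :
    FunctionSpaces.Torus.timeDerivWithin univ (moved (fun _ => Θ) i j P a) t x +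
      ⟪drift i j P (deriv a t) x, FunctionSpaces.Torus.gradient (moved (fun _ => Θ) i j P a t) x⟫_ℝ = 0 := by
  obtain ⟨y, rfl⟩ := proj_surjective x
  set e : E² := EuclideanSpace.single i (1 : ℝ) with he
  have hΘd : Differentiable ℝ (lift Θ) := hΘ.differentiable (by simp)
  -- the time derivative
  have hpath : HasDerivAt (fun τ : ℝ => shearMapLift i j (amp P (a τ)) y) (-((deriv a t * P (y j)) • e)) t := by
    unfold shearMapLift
    simp only [amp_apply]
    have h1 : HasDerivAt (fun τ => a τ * P (y j)) (deriv a t * P (y j)) t :=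
      ((ha.differentiable (by simp)).differentiableAt.hasDerivAt).mul_const _
    have h2 := (h1.smul_const e).const_sub y
    simpa using h2
  have htime : FunctionSpaces.Torus.timeDerivWithin univ (moved (fun _ => Θ) i j P a) t (proj y) =
      fderiv ℝ (lift Θ) (shearMapLift i j (amp P (a t)) y) (-((deriv a t * P (y j)) • e)) := by
    rw [FunctionSpaces.Torus.timeDerivWithin, derivWithin_univ]
    have hfun : (fun τ => moved (fun _ => Θ) i j P a τ (proj y)) = fun τ => lift Θ (shearMapLift i j (amp P (a τ)) y) := by
      funext τ; rw [moved_apply, shearMap_proj, lift_apply]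
    rw [hfun]
    exact ((hΘd _).hasFDerivAt.comp_hasDerivAt t hpath).deriv
  -- the advection term
  obtain ⟨L, hL, hLe⟩ := hasFDerivAt_shearMapLift_apply_single hij P (a t) y
  have hspace : ⟪drift i j P (deriv a t) (proj y), FunctionSpaces.Torus.gradient (moved (fun _ => Θ) i j P a t) (proj y)⟫_ℝ =
      fderiv ℝ (lift Θ) (shearMapLift i j (amp P (a t)) y) ((deriv a t * P (y j)) • e) := by
    rw [real_inner_comm, FunctionSpaces.Torus.inner_gradient_left, ← fderiv_lift]
    have hlift : lift (moved (fun _ => Θ) i j P a t) = lift Θ ∘ shearMapLift i j (amp P (a t)) := by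
      funext y'; rw [lift_apply, Function.comp_apply, moved_apply, shearMap_proj, lift_apply]
    rw [hlift, fderiv_comp y (hΘd _) hL.differentiableAt, hL.fderiv, ContinuousLinearMap.comp_apply]
    congr 1
    rw [drift_apply, proj_apply, ShearProfile.onCircle_coe]
    exact hLe _
  rw [htime, hspace, map_neg, neg_add_cancel]

/-- **A static profile carried by a moving shear is a classical solution of the transport
equation** with the shear drift (zero diffusivity), on the whole time axis. [folklore] -/
theorem isClassicalScalarTransportOn_moved_static {Θ : 𝕋² → ℝ} (hΘ : IsSmooth Θ) (hij : i ≠ j)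
    (P : ShearProfile) {a : ℝ → ℝ} (ha : ContDiff ℝ ∞ a) :
    Torus.IsClassicalScalarTransportOn univ 0 (fun t => drift i j P (deriv a t)) (moved (fun _ => Θ) i j P a) where
  smooth_velocity := isSmoothSpaceTimeOn_drift i j P (ha.deriv') univ
  smooth_scalar := isSmoothSpaceTimeOn_moved (FunctionSpaces.Torus.isSmoothSpaceTimeOn_const hΘ univ) i j P ha
  transport := fun t _ x => by rw [transport_moved_static hΘ hij P ha t x, zero_mul]
  divFree := fun t _ => isDivFree_drift hij P _

/-! ## Bounds and locality -/

/-- **Smooth functions on the torus are bounded** (continuity on a compact space). [folklore] -/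
theorem exists_forall_norm_le {V : Type*} [NormedAddCommGroup V] [NormedSpace ℝ V] {f : 𝕋² → V}
    (hf : IsSmooth f) : ∃ C, 0 ≤ C ∧ ∀ x, ‖f x‖ ≤ C := by
  obtain ⟨C, hC⟩ := isCompact_univ.exists_bound_of_continuousOn hf.continuous.continuousOn
  exact ⟨max C 0, le_max_right _ _, fun x => (hC x (mem_univ x)).trans (le_max_left _ _)⟩

/-- **The Laplacian of the drift is bounded uniformly in the amplitude**: there is `C` with
`‖Δ(drift b)(x)‖ ≤ |b| C` for all `b`, `x`. [folklore] -/
theorem exists_norm_laplacian_drift_le (i j : Fin 2) (P : ShearProfile) :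
    ∃ C, 0 ≤ C ∧ ∀ (b : ℝ) (x : 𝕋²), ‖FunctionSpaces.Torus.laplacian (drift i j P b) x‖ ≤ |b| * C := by
  obtain ⟨C, hC0, hC⟩ := exists_forall_norm_le (isSmooth_drift i j P 1).laplacian
  refine ⟨C, hC0, fun b x => ?_⟩
  have h : drift i j P b = b • drift i j P 1 := by funext y; simp [drift_apply, smul_smul]
  rw [h, Torus.laplacian_const_smul' (isSmooth_drift i j P 1), norm_smul, Real.norm_eq_abs]
  exact mul_le_mul_of_nonneg_left (hC x) (abs_nonneg _)

/-- **Uniform bound of the drift**: `‖drift b x‖ ≤ |b| M` when `|φ| ≤ M`. [folklore] -/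
theorem norm_drift_le (i j : Fin 2) {P : ShearProfile} {M : ℝ} (hM : ∀ t, |P t| ≤ M) (b : ℝ) (x : 𝕋²) :
    ‖drift i j P b x‖ ≤ |b| * M := by
  rw [norm_drift]
  refine mul_le_mul_of_nonneg_left ?_ (abs_nonneg _)
  induction x j using QuotientAddGroup.induction_on with
  | H t => rw [ShearProfile.onCircle_coe]; exact hM t

/-- **Energy of the drift**: `∫ ‖drift b‖² ≤ (|b| M)²` when `|φ| ≤ M`. [folklore] -/
theorem integral_norm_sq_drift_le (i j : Fin 2) {P : ShearProfile} {M : ℝ} (hM : ∀ t, |P t| ≤ M) (b : ℝ) :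
    ∫ x, ‖drift i j P b x‖ ^ 2 ≤ (|b| * M) ^ 2 := by
  have h : ∀ x, ‖drift i j P b x‖ ^ 2 ≤ (|b| * M) ^ 2 := fun x =>
    pow_le_pow_left₀ (norm_nonneg _) (norm_drift_le i j hM b x) 2
  calc ∫ x, ‖drift i j P b x‖ ^ 2 ≤ ∫ _ : 𝕋², (|b| * M) ^ 2 :=
        integral_mono (integrable_norm_sq_of_continuous (isSmooth_drift i j P b).continuous) (integrable_const _) h
    _ = (|b| * M) ^ 2 := by simp

/-- **Locality of the time derivative**: fields that agree near a time have the same time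
derivative there (within `univ`). [folklore] -/
theorem timeDerivWithin_univ_congr {V : Type*} [NormedAddCommGroup V] [NormedSpace ℝ V] {θ₁ θ₂ : ℝ → 𝕋² → V}
    {t : ℝ} (h : ∀ᶠ τ in 𝓝 t, θ₁ τ = θ₂ τ) (x : 𝕋²) :
    FunctionSpaces.Torus.timeDerivWithin univ θ₁ t x = FunctionSpaces.Torus.timeDerivWithin univ θ₂ t x := by
  rw [FunctionSpaces.Torus.timeDerivWithin, FunctionSpaces.Torus.timeDerivWithin, derivWithin_univ, derivWithin_univ]
  have h' : (fun τ => θ₁ τ x) =ᶠ[𝓝 t] fun τ => θ₂ τ x := h.mono fun τ hτ => by simp only [hτ]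
  exact h'.deriv_eq

/-- **Locality of the transport identity**: if the scalar fields agree near `t` and the drifts
agree at `t`, the transport residuals at `t` agree. [folklore] -/
theorem transport_congr {θ₁ θ₂ : ℝ → 𝕋² → ℝ} {v₁ v₂ : ℝ → 𝕋² → E²} {t : ℝ}
    (hθ : ∀ᶠ τ in 𝓝 t, θ₁ τ = θ₂ τ) (hv : v₁ t = v₂ t) (x : 𝕋²) :
    FunctionSpaces.Torus.timeDerivWithin univ θ₁ t x + ⟪v₁ t x, FunctionSpaces.Torus.gradient (θ₁ t) x⟫_ℝ =
      FunctionSpaces.Torus.timeDerivWithin univ θ₂ t x + ⟪v₂ t x, FunctionSpaces.Torus.gradient (θ₂ t) x⟫_ℝ := by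
  rw [timeDerivWithin_univ_congr hθ x, hv, show θ₁ t = θ₂ t from hθ.self_of_nhds]

end ShearStage

end Literature.Analysis.FluidPDE
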